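import Summits.AtomisticToContinuum.Crystallization.Theses.DisclinationRation
import Summits.AtomisticToContinuum.Crystallization.Theorems.HullExactificationCascadeHullGoodEverywhereDense
import Summits.AtomisticToContinuum.Crystallization.Theorems.DisclinationRationAlphabetGoodHullElementStubAlphabetGoodRelDense
import Summits.AtomisticToContinuum.Crystallization.Theorems.ChessboardParticlePlanesPeriodicWindowsGoodLimitB
import Summits.AtomisticToContinuum.Crystallization.Theorems.AlphabetGoodHullElement.Negative.FlatHullElement

/-!
# `AlphabetGoodHullElement` (crux stmt-AtomisticToContinuum-15798, route `DisclinationRation`),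
# negative side III: the ROOT of a flat hull element is never alphabet-good

The crux asks, for every sequence of Lennard-Jones ground states, for SOME rooted hull element
`S ∋ 0` that is separated, relatively dense and everywhere alphabet-good (`GA S y`: the strict
`13/10·d` shell of `y`, rescaled by `d⁻¹`, is `1/20`-matched through a bijection and a linear
isometry to the fcc, the hcp or the twelve-point decahedral-axis pattern).

This file (refuter, cdisprove seat, cycle 1; statements spelled out, no proposition defined under
`Summits/`) sharpens negative side II (`FlatHullElement.lean`) from "not relatively dense" to
"bad at the root":

* covering input: each of the three patterns SEES EVERY DIRECTION, `∀ u, ∃ v ∈ pattern,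
  ‖u‖ ≤ 5 ⟪u, v⟫` — landed `hge_fcc_cover`, `hge_hcp_cover` and, for the decahedral-axis pattern,
  the prover's `AlphabetGoodHullElementBirth.agrd_dec_cover` (stub 3 of line `birth`), reused here.
* `no_flat_match` — a pattern seeing every direction is never `1/20`-matched (bijection + linear
  isometry, any rescaling `r ≥ 0`) to a shell all of whose points have first coordinate `≤` that of
  the centre: the isometry is onto, so some pattern vector has image with first coordinate `≥ 1/5`,
  while its matched shell point has first coordinate `≤ 0`.
* `not_alphabetGood_of_flat` — hence `GA S y` (VERBATIM) fails whenever `S ⊆ {s | s 0 ≤ y 0}`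
  (fcc/hcp: `hge_fcc_cover`, `hge_hcp_cover`; decahedral: `agrd_dec_cover`).
* `exists_rooted_hullElement_root_not_good`, `not_forall_rooted_hullElement_root_good` — every
  sequence of Lennard-Jones ground states has a rooted separated hull element whose ROOT is not
  alphabet-good (the flat element of `exists_flat_rooted_hullElement`), so the crux's `∃ S` cannot
  be upgraded to `∀ S` even for goodness at one point.

This file does NOT refute the crux.  All `[folklore]`.
-/

noncomputable section

namespace Summit.AtomisticToContinuum.Crystallization.Theorems.AlphabetGoodHullElementNegative

open Literature.MathematicalPhysics.StatisticalMechanics Literature.Geometry.DiscreteGeometry Filter Topology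
open scoped RealInnerProductSpace
open Summit.AtomisticToContinuum.Crystallization.Theorems.PeriodicWindowsSketch (gl_coord_sub_le_dist)
open Summit.AtomisticToContinuum.Crystallization.Theorems.AlphabetGoodHullElementBirth (agrd_dec_cover)

/-! ## Flat shells are never matched -/

/-- **No pattern seeing every direction matches a flat shell.** If every direction is `5`-seen by
some `f v`, the points of `T` have first coordinate `≤ y 0`, `r ≥ 0`, and a bijection `e : T ≃ β`
with a linear isometry `A` puts every `r • (t - y)` within `1/20` of `A (f (e t))`, contradiction:
`A` is onto, so some `f v` has `(A (f v)) 0 ≥ 1/5`, while its matched shell point has first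
coordinate `≤ 0`. [folklore] -/
theorem no_flat_match {β : Type*} (f : β → EuclideanSpace ℝ (Fin 3))
    (hP : ∀ u : EuclideanSpace ℝ (Fin 3), ∃ v : β, ‖u‖ ≤ 5 * ⟪u, f v⟫)
    {T : Set (EuclideanSpace ℝ (Fin 3))} {y : EuclideanSpace ℝ (Fin 3)} (hT : ∀ t ∈ T, t 0 ≤ y 0)
    {r : ℝ} (hr : 0 ≤ r) (A : EuclideanSpace ℝ (Fin 3) →ₗᵢ[ℝ] EuclideanSpace ℝ (Fin 3)) (e : ↥T ≃ β)
    (h : ∀ t : ↥T, dist (r • ((t : EuclideanSpace ℝ (Fin 3)) - y)) (A (f (e t))) ≤ 1 / 20) : False := by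
  set A' : EuclideanSpace ℝ (Fin 3) ≃ₗᵢ[ℝ] EuclideanSpace ℝ (Fin 3) := A.toLinearIsometryEquiv rfl with hA'
  set w : EuclideanSpace ℝ (Fin 3) := A'.symm (EuclideanSpace.single (0 : Fin 3) (1 : ℝ)) with hw
  obtain ⟨v, hcov⟩ := hP w
  have hw1 : ‖w‖ = 1 := by
    rw [hw, LinearIsometryEquiv.norm_map]; simp
  have hAv : A (f v) = A' (f v) := by rw [hA', LinearIsometry.toLinearIsometryEquiv_apply]
  have hAv0 : (A (f v)) 0 = ⟪w, f v⟫ := by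
    have h1 : (A (f v)) 0 = ⟪A (f v), EuclideanSpace.single (0 : Fin 3) (1 : ℝ)⟫ := by
      rw [EuclideanSpace.inner_single_right]; simp
    rw [h1, hAv, show EuclideanSpace.single (0 : Fin 3) (1 : ℝ) = A' w from (A'.apply_symm_apply _).symm,
      A'.inner_map_map, real_inner_comm]
  have h15 : 1 / 5 ≤ (A (f v)) 0 := by rw [hAv0]; linarith
  -- the matched shell point
  set t : ↥T := e.symm v with ht
  have hmatch := h t
  have het : e t = v := by rw [ht, Equiv.apply_symm_apply]
  rw [het] at hmatch
  have hcoord := gl_coord_sub_le_dist (r • ((t : EuclideanSpace ℝ (Fin 3)) - y)) (A (f v)) 0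
  have hflat : (r • ((t : EuclideanSpace ℝ (Fin 3)) - y)) 0 ≤ 0 := by
    rw [PiLp.smul_apply, PiLp.sub_apply, smul_eq_mul]
    exact mul_nonpos_of_nonneg_of_nonpos hr (sub_nonpos.2 (hT _ t.2))
  have := (abs_le.1 (hcoord.trans hmatch)).1
  linarith

/-- **The root of a flat configuration is never alphabet-good.** If all points of `S` have first
coordinate `≤ y 0`, the route's alphabet-goodness clause `GA S y` (VERBATIM) fails at `y`: each of
the three patterns sees every direction (`hge_fcc_cover`, `hge_hcp_cover`, `agrd_dec_cover`).
[folklore] -/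
theorem not_alphabetGood_of_flat {S : Set (EuclideanSpace ℝ (Fin 3))} {y : EuclideanSpace ℝ (Fin 3)}
    (hS : ∀ s ∈ S, s 0 ≤ y 0) :
    ¬ (let d : ℝ := sInf ((fun z => dist z y) '' (S \ {y})); let T : Set (EuclideanSpace ℝ (Fin 3)) := {z : EuclideanSpace ℝ (Fin 3) | z ∈ S ∧ z ≠ y ∧ dist z y < 13 / 10 * d}; ∃ A : EuclideanSpace ℝ (Fin 3) →ₗᵢ[ℝ] EuclideanSpace ℝ (Fin 3), (∃ e : ↥T ≃ ↥Literature.Geometry.DiscreteGeometry.fccKissingPattern, ∀ t : ↥T, dist (d⁻¹ • ((t : EuclideanSpace ℝ (Fin 3)) - y)) (A ((e t : ↥Literature.Geometry.DiscreteGeometry.fccKissingPattern) : EuclideanSpace ℝ (Fin 3))) ≤ 1 / 20) ∨ (∃ e : ↥T ≃ ↥Literature.Geometry.DiscreteGeometry.hcpKissingPattern, ∀ t : ↥T, dist (d⁻¹ • ((t : EuclideanSpace ℝ (Fin 3)) - y)) (A ((e t : ↥Literature.Geometry.DiscreteGeometry.hcpKissingPattern) : EuclideanSpace ℝ (Fin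 3))) ≤ 1 / 20) ∨ (∃ e : ↥T ≃ ↥{p : EuclideanSpace ℝ (Fin 3) | p = !₂[(0 : ℝ), 0, 1] ∨ p = !₂[(0 : ℝ), 0, -1] ∨ ∃ k : Fin 5, ∃ σ : ℝ, (σ = 1 / 2 ∨ σ = -(1 / 2)) ∧ p = !₂[Real.sqrt 3 / 2 * Real.cos (2 * Real.pi * (k : ℝ) / 5), Real.sqrt 3 / 2 * Real.sin (2 * Real.pi * (k : ℝ) / 5), σ]}, ∀ t : ↥T, dist (d⁻¹ • ((t : EuclideanSpace ℝ (Fin 3)) - y)) (A ((e t : ↥{p : EuclideanSpace ℝ (Fin 3) | p = !₂[(0 : ℝ), 0, 1] ∨ p = !₂[(0 : ℝ), 0, -1] ∨ ∃ k : Fin 5, ∃ σ : ℝ, (σ = 1 / 2 ∨ σ = -(1 / 2)) ∧ p = !₂[Real.sqrt 3 / 2 * Real.cos (2 * Real.pi * (k : ℝ) / 5), Real.sqrt 3 / 2 * Real.sin (2 * Real.pi * (k : ℝ) / 5), σ]}) : EuclideanSpace ℝ (Fin 3))) ≤ 1 / 20)) := by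
  intro h
  have hd : 0 ≤ (sInf ((fun z => dist z y) '' (S \ {y})))⁻¹ := by
    refine inv_nonneg.2 (Real.sInf_nonneg ?_)
    rintro _ ⟨z, -, rfl⟩
    exact dist_nonneg
  have hT : ∀ t ∈ {z : EuclideanSpace ℝ (Fin 3) | z ∈ S ∧ z ≠ y ∧
      dist z y < 13 / 10 * sInf ((fun z => dist z y) '' (S \ {y}))}, t 0 ≤ y 0 :=
    fun t ht => hS t ht.1
  obtain ⟨A, ⟨e, he⟩ | ⟨e, he⟩ | ⟨e, he⟩⟩ := h
  · exact no_flat_match (fun v : ↥fccKissingPattern => (v : EuclideanSpace ℝ (Fin 3)))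
      (fun u => by
        obtain ⟨v, hv, huv⟩ := hge_fcc_cover u
        exact ⟨⟨v, hv⟩, huv⟩) hT hd A e he
  · exact no_flat_match (fun v : ↥hcpKissingPattern => (v : EuclideanSpace ℝ (Fin 3)))
      (fun u => by
        obtain ⟨v, hv, huv⟩ := hge_hcp_cover u
        exact ⟨⟨v, hv⟩, huv⟩) hT hd A e he
  · exact no_flat_match (fun v : ↥({p : EuclideanSpace ℝ (Fin 3) | p = !₂[(0 : ℝ), 0, 1] ∨ p = !₂[(0 : ℝ), 0, -1] ∨ ∃ k : Fin 5, ∃ σ : ℝ, (σ = 1 / 2 ∨ σ = -(1 / 2)) ∧ p = !₂[Real.sqrt 3 / 2 * Real.cos (2 * Real.pi * (k : ℝ) / 5), Real.sqrt 3 / 2 * Real.sin (2 * Real.pi * (k : ℝ) / 5), σ]} : Set (EuclideanSpace ℝ (Fin 3))) => (v : EuclideanSpace ℝ (Fin 3)))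
      (fun u => by
        obtain ⟨v, hv, huv⟩ := agrd_dec_cover u
        exact ⟨⟨v, hv⟩, huv⟩) hT hd A e he

/-! ## Consequence for the crux: a rooted hull element with a BAD ROOT in every ground-state hull -/

/-- **Every sequence of Lennard-Jones ground states has a rooted, separated hull element whose ROOT
is not alphabet-good** (the flat hull element of `exists_flat_rooted_hullElement`, seen from a
particle of maximal first coordinate; the clause negated is the crux's `GA S 0` VERBATIM).  So the
crux's `∃ S` cannot be upgraded to `∀ S` even for goodness at the root alone. [folklore] -/
theorem exists_rooted_hullElement_root_not_good (x : (N : ℕ) → (Fin N → EuclideanSpace ℝ (Fin 3)))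
    (hx : ∀ N, IsGroundState lennardJones (x N)) :
    ∃ S : Set (EuclideanSpace ℝ (Fin 3)), ∃ δ : ℝ, 0 < δ ∧ (∀ y ∈ S, ∀ z ∈ S, y ≠ z → δ ≤ dist y z) ∧
      (0 : EuclideanSpace ℝ (Fin 3)) ∈ S ∧
      (∃ φ : ℕ → ℕ, StrictMono φ ∧ ∃ τ : ℕ → EuclideanSpace ℝ (Fin 3), ∀ R ε : ℝ, 0 < ε →
        ∀ᶠ j : ℕ in Filter.atTop,
          (∀ s ∈ S, ‖s‖ ≤ R → ∃ i : Fin (φ j), dist (x (φ j) i + τ j) s ≤ ε) ∧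
          (∀ i : Fin (φ j), ‖x (φ j) i + τ j‖ ≤ R → ∃ s ∈ S, dist (x (φ j) i + τ j) s ≤ ε)) ∧
      ¬ (let d : ℝ := sInf ((fun z => dist z (0 : EuclideanSpace ℝ (Fin 3))) '' (S \ {(0 : EuclideanSpace ℝ (Fin 3))})); let T : Set (EuclideanSpace ℝ (Fin 3)) := {z : EuclideanSpace ℝ (Fin 3) | z ∈ S ∧ z ≠ (0 : EuclideanSpace ℝ (Fin 3)) ∧ dist z (0 : EuclideanSpace ℝ (Fin 3)) < 13 / 10 * d}; ∃ A : EuclideanSpace ℝ (Fin 3) →ₗᵢ[ℝ] EuclideanSpace ℝ (Fin 3), (∃ e : ↥T ≃ ↥Literature.Geometry.DiscreteGeometry.fccKissingPattern, ∀ t : ↥T, dist (d⁻¹ • ((t : EuclideanSpace ℝ (Fin 3)) - (0 : EuclideanSpace ℝ (Fin 3)))) (A ((e t : ↥Literature.Geometry.DiscreteGeometry.fccKissingPattern) : EuclideanSpace ℝ (Fin 3))) ≤ 1 / 20) ∨ (∃ e : ↥T ≃ ↥Literature.Geometry.DiscreteGeometry.hcpKissingPattern, ∀ t : ↥T, dist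 (d⁻¹ • ((t : EuclideanSpace ℝ (Fin 3)) - (0 : EuclideanSpace ℝ (Fin 3)))) (A ((e t : ↥Literature.Geometry.DiscreteGeometry.hcpKissingPattern) : EuclideanSpace ℝ (Fin 3))) ≤ 1 / 20) ∨ (∃ e : ↥T ≃ ↥{p : EuclideanSpace ℝ (Fin 3) | p = !₂[(0 : ℝ), 0, 1] ∨ p = !₂[(0 : ℝ), 0, -1] ∨ ∃ k : Fin 5, ∃ σ : ℝ, (σ = 1 / 2 ∨ σ = -(1 / 2)) ∧ p = !₂[Real.sqrt 3 / 2 * Real.cos (2 * Real.pi * (k : ℝ) / 5), Real.sqrt 3 / 2 * Real.sin (2 * Real.pi * (k : ℝ) / 5), σ]}, ∀ t : ↥T, dist (d⁻¹ • ((t : EuclideanSpace ℝ (Fin 3)) - (0 : EuclideanSpace ℝ (Fin 3)))) (A ((e t : ↥{p : EuclideanSpace ℝ (Fin 3) | p = !₂[(0 : ℝ), 0, 1] ∨ p = !₂[(0 : ℝ), 0, -1] ∨ ∃ k : Fin 5, ∃ σ : ℝ, (σ = 1 / 2 ∨ σ = -(1 / 2)) ∧ p = !₂[Real.sqrt 3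 / 2 * Real.cos (2 * Real.pi * (k : ℝ) / 5), Real.sqrt 3 / 2 * Real.sin (2 * Real.pi * (k : ℝ) / 5), σ]}) : EuclideanSpace ℝ (Fin 3))) ≤ 1 / 20)) := by
  obtain ⟨δ, hδ, hsepall⟩ := LennardJonesMinimalDistance_holds
  obtain ⟨S, hSsep, h0, hHL, hflat⟩ :=
    exists_flat_rooted_hullElement x hδ fun N i j hij => hsepall N (x N) (hx N) i j hij
  refine ⟨S, δ, hδ, hSsep, h0, hHL, ?_⟩
  exact not_alphabetGood_of_flat (S := S) (y := 0) fun s hs => by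
    rw [PiLp.zero_apply]; exact hflat s hs

/-- **Refuted strengthening (root form)**: it is false that in every rooted hull element of every
Lennard-Jones ground-state sequence the root is alphabet-good. [folklore] -/
theorem not_forall_rooted_hullElement_root_good :
    ¬ ∀ x : (N : ℕ) → (Fin N → EuclideanSpace ℝ (Fin 3)), (∀ N, IsGroundState lennardJones (x N)) →
      ∀ S : Set (EuclideanSpace ℝ (Fin 3)), (0 : EuclideanSpace ℝ (Fin 3)) ∈ S →
        (∃ φ : ℕ → ℕ, StrictMono φ ∧ ∃ τ : ℕ → EuclideanSpace ℝ (Fin 3), ∀ R ε : ℝ, 0 < ε →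
        ∀ᶠ j : ℕ in Filter.atTop,
          (∀ s ∈ S, ‖s‖ ≤ R → ∃ i : Fin (φ j), dist (x (φ j) i + τ j) s ≤ ε) ∧
          (∀ i : Fin (φ j), ‖x (φ j) i + τ j‖ ≤ R → ∃ s ∈ S, dist (x (φ j) i + τ j) s ≤ ε)) →
        (let d : ℝ := sInf ((fun z => dist z (0 : EuclideanSpace ℝ (Fin 3))) '' (S \ {(0 : EuclideanSpace ℝ (Fin 3))})); let T : Set (EuclideanSpace ℝ (Fin 3)) := {z : EuclideanSpace ℝ (Fin 3) | z ∈ S ∧ z ≠ (0 : EuclideanSpace ℝ (Fin 3)) ∧ dist z (0 : EuclideanSpace ℝ (Fin 3)) < 13 / 10 * d}; ∃ A : EuclideanSpace ℝ (Fin 3) →ₗᵢ[ℝ] EuclideanSpace ℝ (Fin 3), (∃ e : ↥T ≃ ↥Literature.Geometry.DiscreteGeometry.fccKissingPattern, ∀ t : ↥T, dist (d⁻¹ • ((t : EuclideanSpace ℝ (Fin 3)) - (0 : EuclideanSpace ℝ (Fin 3)))) (A ((e t : ↥Literature.Geometry.DiscreteGeometry.fccKissingPattern) : EuclideanSpace ℝ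 (Fin 3))) ≤ 1 / 20) ∨ (∃ e : ↥T ≃ ↥Literature.Geometry.DiscreteGeometry.hcpKissingPattern, ∀ t : ↥T, dist (d⁻¹ • ((t : EuclideanSpace ℝ (Fin 3)) - (0 : EuclideanSpace ℝ (Fin 3)))) (A ((e t : ↥Literature.Geometry.DiscreteGeometry.hcpKissingPattern) : EuclideanSpace ℝ (Fin 3))) ≤ 1 / 20) ∨ (∃ e : ↥T ≃ ↥{p : EuclideanSpace ℝ (Fin 3) | p = !₂[(0 : ℝ), 0, 1] ∨ p = !₂[(0 : ℝ), 0, -1] ∨ ∃ k : Fin 5, ∃ σ : ℝ, (σ = 1 / 2 ∨ σ = -(1 / 2)) ∧ p = !₂[Real.sqrt 3 / 2 * Real.cos (2 * Real.pi * (k : ℝ) / 5), Real.sqrt 3 / 2 * Real.sin (2 * Real.pi * (k : ℝ) / 5), σ]}, ∀ t : ↥T, dist (d⁻¹ • ((t : EuclideanSpace ℝ (Fin 3)) - (0 : EuclideanSpace ℝ (Fin 3)))) (A ((e t : ↥{p : EuclideanSpace ℝ (Fin 3) | p = !₂[(0 : ℝ), 0, 1] ∨ p = !₂[(0 : ℝ),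 0, -1] ∨ ∃ k : Fin 5, ∃ σ : ℝ, (σ = 1 / 2 ∨ σ = -(1 / 2)) ∧ p = !₂[Real.sqrt 3 / 2 * Real.cos (2 * Real.pi * (k : ℝ) / 5), Real.sqrt 3 / 2 * Real.sin (2 * Real.pi * (k : ℝ) / 5), σ]}) : EuclideanSpace ℝ (Fin 3))) ≤ 1 / 20)) := by
  intro h
  choose x hx using LennardJonesGroundStatesExist_holds
  obtain ⟨S, δ, -, -, h0, hHL, hbad⟩ := exists_rooted_hullElement_root_not_good x hx
  exact hbad (h x hx S h0 hHL)

end Summit.AtomisticToContinuum.Crystallization.Theorems.AlphabetGoodHullElementNegative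

end
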